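import Literature.RingTheory.HilbertSamuel.NormalFlatnessHilbertFunction
import Literature.RingTheory.HilbertSamuel.NormalFlatness
import Literature.RingTheory.HilbertSamuel.Quotient
import Literature.RingTheory.HilbertSamuel.InitialFormOfElement
import Literature.RingTheory.HilbertSamuel.HilbertSamuelFunction
import Literature.AlgebraicGeometry.Resolution.AdicCompletionRegular
import Literature.AlgebraicGeometry.Resolution.RegularLocalHeights
import Literature.AlgebraicGeometry.Resolution.SmoothImpliesRegular
import Literature.AlgebraicGeometry.Resolution.RegularLocalOrderValuation
import Literature.AlgebraicGeometry.Resolution.OrderGenerization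
import Mathlib.RingTheory.Localization.Ideal
import HarnessLib

/-!
# Crux `PatchingRelPerfect` (stmt-ResolutionOfSingularities-16161), chain W5.2 — F7(β) (β-AX) T3 / LC: the EXTRACTION LEMMA (EQ)
# «a hypersurface permissible along a regular centre is EQUIMULTIPLE along it»

[OURS · L1 W5.2 · F7(β) (β-AX) · res-L1-w52-plan-1 RULING G12-1 (3) / NOTE G12-8] res-L1-w52-stub-1 g5.  Replaces the role of NO printed item;
NOT a statement of the manuscript under review (AI-written, weaker than expert review).  The classical «normally flat hypersurface ⇒
equimultiple» (Hironaka 1964 Ch. II; CJS 2020 Thm 3.3), DERIVED from the tree's Hilbert-function form of Bennett / CJS Thm 3.3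
(`hilbertFun_eq_hilbertSamuelFun_of_isNormallyFlat`) without graded-algebra computations:
* §1 low degrees of a hypersurface section (`hilbertFun_eq_of_ker_le_pow`, `hilbertFun_add_one_eq_of_ker_eq_span`) and first-difference
  bookkeeping of iterated partial sums (`iterPSum_eq_of_eq_below`, `iterPSum_add_one_eq`);
* §2 **`mOrder_eq_mOrder_localization_of_isPermissible`** (S regular local, S/p regular, `h ∈ p ∖ 0`, `p/(h)` permissible in `S/(h)` ⟹
  `ord_𝔪 h = ord_{S_p} h`): `H_{S/(h)} = H⁽ʳ⁾_{S_p/(h)}`, `H_S = Φ⁽ᵈ⁾`, `H_{S_p} = Φ⁽ᶜ⁾`, `d = c + r`, and §1 read at `n = min(ν, μ)`;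
* §3 factor corollaries: `mOrder_mul` / `mOrder_prod` / `mOrder_pow` (= the tree's `adicOrder_mul`), `mOrder_localization_le` (= the tree's
  `mem_pow_of_algebraMap_mem_pow`), **`mOrder_eq_mOrder_localization_of_prod`** (every factor of `h = ∏ gᵢ`),
  **`mOrder_eq_mOrder_localization_of_dvd_pow`** (every divisor of a power of `h` — non-reduced host traces), `isUnit_of_dvd_pow_of_not_mem`.
Fact-free.

## References
* V. Cossart, U. Jannsen, S. Saito, LNM 2270 (2020), Def. 3.1, Thm. 3.3. [CossartJannsenSaito2020]
* H. Hironaka, Ann. of Math. 79 (1964), Ch. II §1 (normal flatness and equimultiplicity). [Hironaka1964]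
-/

-- `Summit.<Summit>.<Sub>.Theorems` with `Sub = Summit` (single-conjunct summit, D-0017)
set_option linter.dupNamespace false

noncomputable section

open IsLocalRing Finset
open Literature.RingTheory.HilbertSamuel

namespace Summit.ResolutionOfSingularities.ResolutionOfSingularities.Theorems.DepthEquimultiple

universe u v

/-! ## §1 Low degrees of a hypersurface section -/
section LowDegrees

variable {A : Type u} {B : Type v} [CommRing A] [CommRing B] [IsLocalRing A] [IsLocalRing B] [IsNoetherianRing A]
  [Algebra A B] (hf : Function.Surjective (algebraMap A B))

omit [IsNoetherianRing A] in
include hf in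
/-- An element of `𝔪_Aⁿ` whose image lies in `𝔪_Bⁿ⁺¹` lies in `𝔪_Aⁿ⁺¹ + ker`. [folklore] -/
theorem exists_sub_mem_ker_of_map_mem_pow_succ {n : ℕ} {a : A} (ha : algebraMap A B a ∈ maximalIdeal B ^ (n + 1)) :
    ∃ a' ∈ maximalIdeal A ^ (n + 1), a - a' ∈ RingHom.ker (algebraMap A B) := by
  rw [← map_pow_maximalIdeal_eq_of_surjective hf (n + 1), Ideal.mem_map_iff_of_surjective _ hf] at ha
  obtain ⟨a', ha', he⟩ := ha
  exact ⟨a', ha', by rw [RingHom.mem_ker, map_sub, he, sub_self]⟩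

omit [IsNoetherianRing A] in
include hf in
/-- The kernel of the map on graded pieces in degree `n`, read on representatives. [folklore] -/
theorem gradedPieceMap_mk_eq_zero_iff (n : ℕ) (x : ↥(maximalIdeal A ^ n)) :
    gradedPieceMap hf n (gradedPiece.mk _ n x) = 0 ↔ ∃ a' ∈ maximalIdeal A ^ (n + 1), (x : A) - a' ∈ RingHom.ker (algebraMap A B) := by
  rw [gradedPieceMap_mk, gradedPiece.mk_eq_zero_iff, coe_powMaximalIdealMap_apply]
  refine ⟨exists_sub_mem_ker_of_map_mem_pow_succ hf, ?_⟩
  rintro ⟨a', ha', hk⟩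
  have : algebraMap A B x = algebraMap A B a' := by
    rw [RingHom.mem_ker, map_sub, sub_eq_zero] at hk; exact hk
  rw [this, ← map_pow_maximalIdeal_eq_of_surjective hf (n + 1)]
  exact Ideal.mem_map_of_mem _ ha'

include hf in
/-- **Below the order of the kernel nothing changes**: if `ker (A → B) ⊆ 𝔪ᴺ` then `H_B(n) = H_A(n)` for `n < N`. [folklore] -/
theorem hilbertFun_eq_of_ker_le_pow {N : ℕ} (hK : RingHom.ker (algebraMap A B) ≤ maximalIdeal A ^ N) {n : ℕ} (hn : n < N) :
    hilbertFun B n = hilbertFun A n := by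
  -- the map on graded pieces is injective in degree `n`
  have hinj : Function.Injective (gradedPieceMap hf n) := by
    rw [← LinearMap.ker_eq_bot, LinearMap.ker_eq_bot']
    intro q hq
    obtain ⟨x, rfl⟩ := gradedPiece.mk_surjective _ n q
    obtain ⟨a', ha', hk⟩ := (gradedPieceMap_mk_eq_zero_iff hf n x).mp hq
    rw [gradedPiece.mk_eq_zero_iff]
    have hx : (x : A) = a' + ((x : A) - a') := by ring
    rw [hx]
    exact Ideal.add_mem _ ha' (Ideal.pow_le_pow_right hn (hK hk))
  have h := (LinearEquiv.ofBijective (gradedPieceMap hf n) ⟨hinj, gradedPieceMap_surjective hf n⟩).length_eq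
  rw [length_gradedPiece_eq_hilbertFun, length_gradedPiece_target_eq_hilbertFun hf] at h
  exact_mod_cast h.symm

include hf in
/-- **At the order of a principal kernel the Hilbert function drops by one**: if `ker (A → B) = (t)` with `t ∈ 𝔪ᵛ ∖ 𝔪ᵛ⁺¹` then
`H_B(ν) + 1 = H_A(ν)` (the kernel of `𝔪ᵛ/𝔪ᵛ⁺¹ → 𝔪̄ᵛ/𝔪̄ᵛ⁺¹` is the residue line spanned by `t̄`). [folklore] -/
theorem hilbertFun_add_one_eq_of_ker_eq_span {t : A} {ν : ℕ} (hK : RingHom.ker (algebraMap A B) = Ideal.span {t})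
    (ht : t ∈ maximalIdeal A ^ ν) (ht' : t ∉ maximalIdeal A ^ (ν + 1)) : hilbertFun B ν + 1 = hilbertFun A ν := by
  set v : gradedPiece (maximalIdeal A) ν := gradedPiece.mk _ ν ⟨t, ht⟩ with hv_def
  -- the kernel is the line through `v`
  have hker : LinearMap.ker (gradedPieceMap hf ν) = Submodule.span A {v} := by
    refine le_antisymm ?_ ?_
    · intro q hq
      obtain ⟨x, rfl⟩ := gradedPiece.mk_surjective _ ν q
      obtain ⟨a', ha', hk⟩ := (gradedPieceMap_mk_eq_zero_iff hf ν x).mp hq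
      rw [hK, Ideal.mem_span_singleton'] at hk
      obtain ⟨c, hc⟩ := hk
      have hx : x = ⟨a', Ideal.pow_le_pow_right (Nat.le_succ ν) ha'⟩ + c • (⟨t, ht⟩ : ↥(maximalIdeal A ^ ν)) := by
        apply Subtype.ext
        simp only [Submodule.coe_add, SetLike.val_smul, smul_eq_mul]
        rw [hc]; ring
      rw [hx, map_add, map_smul, (gradedPiece.mk_eq_zero_iff _ ν _).mpr ha', zero_add]
      exact Submodule.smul_mem _ c (Submodule.subset_span rfl)
    · rw [Submodule.span_singleton_le_iff_mem, LinearMap.mem_ker, hv_def, gradedPieceMap_mk_eq_zero_iff hf]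
      exact ⟨0, Submodule.zero_mem _, by rw [sub_zero, hK]; exact Ideal.mem_span_singleton_self t⟩
  -- `v ≠ 0` and `𝔪 v = 0`, so the line is a copy of the residue field: length `1`
  have hv0 : v ≠ 0 := fun h => ht' ((gradedPiece.mk_eq_zero_iff _ ν _).mp h)
  have hann : LinearMap.ker (LinearMap.toSpanSingleton A _ v) = maximalIdeal A := by
    refine le_antisymm (IsLocalRing.le_maximalIdeal fun h => hv0 ?_) fun m hm => ?_
    · rw [Ideal.eq_top_iff_one, LinearMap.mem_ker, LinearMap.toSpanSingleton_apply, one_smul] at h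
      exact h
    · rw [LinearMap.mem_ker, LinearMap.toSpanSingleton_apply, hv_def, ← map_smul, gradedPiece.mk_eq_zero_iff]
      change m * t ∈ maximalIdeal A ^ (ν + 1)
      rw [pow_succ']
      exact Ideal.mul_mem_mul hm ht
  have hline : Module.length A ↥(Submodule.span A {v}) = 1 := by
    have e := (LinearMap.toSpanSingleton A _ v).quotKerEquivRange
    rw [LinearMap.range_toSpanSingleton, hann] at e
    rw [← e.length_eq]
    haveI : IsSimpleModule A (A ⧸ maximalIdeal A) := isSimpleModule_iff_isCoatom.mpr (Ideal.isMaximal_def.mp inferInstance)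
    exact Module.length_eq_one _ _
  -- lengths along `0 → ker → gr_ν(A) → gr_ν(B) → 0`
  have hadd := Module.length_eq_add_of_exact (LinearMap.ker (gradedPieceMap hf ν)).subtype (gradedPieceMap hf ν)
    (Submodule.subtype_injective _) (gradedPieceMap_surjective hf ν) (LinearMap.exact_subtype_ker_map _)
  rw [length_gradedPiece_target_eq_hilbertFun hf, length_gradedPiece_eq_hilbertFun, hker, hline] at hadd
  have : ((hilbertFun A ν : ℕ) : ℕ∞) = ((1 + hilbertFun B ν : ℕ) : ℕ∞) := by rw [hadd]; push_cast; rfl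
  have := ENat.coe_inj.mp this
  omega

end LowDegrees
/-- Functions agreeing below `n` have iterated partial sums agreeing below `n`. [folklore] -/
theorem iterPSum_eq_of_eq_below {f g : ℕ → ℕ} {n : ℕ} (h : ∀ i < n, f i = g i) (r : ℕ) : ∀ i < n, iterPSum r f i = iterPSum r g i := by
  induction r with
  | zero => exact h
  | succ r ih =>
    intro i hi
    rw [iterPSum_succ, iterPSum_succ, psum_apply, psum_apply]
    exact Finset.sum_congr rfl fun j hj => ih j (lt_of_lt_of_le (Finset.mem_range.mp hj) hi)

/-- If `f` agrees with `g` below `n` and `f n + 1 = g n`, the same holds for all iterated partial sums. [folklore] -/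
theorem iterPSum_add_one_eq {f g : ℕ → ℕ} {n : ℕ} (h : ∀ i < n, f i = g i) (hn : f n + 1 = g n) (r : ℕ) :
    iterPSum r f n + 1 = iterPSum r g n := by
  induction r with
  | zero => exact hn
  | succ r ih =>
    rw [iterPSum_succ, iterPSum_succ, psum_apply, psum_apply, Finset.sum_range_succ, Finset.sum_range_succ, add_assoc, ih,
      Finset.sum_congr rfl fun j hj => iterPSum_eq_of_eq_below h r j (Finset.mem_range.mp hj)]

/-! ## §2 Equimultiplicity from permissibility -/
section Main

variable {S : Type u} [CommRing S]

/-- In the quotient by an ideal `I ≤ p`, the image of the prime complement of `p` is the prime complement of `p̄`. [folklore] -/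
theorem algebraMapSubmonoid_quotient_eq (p I : Ideal S) [p.IsPrime] [(p.map (Ideal.Quotient.mk I)).IsPrime] (hIp : I ≤ p) :
    Algebra.algebraMapSubmonoid (S ⧸ I) p.primeCompl = (p.map (Ideal.Quotient.mk I)).primeCompl := by
  have hcomap : (p.map (Ideal.Quotient.mk I)).comap (Ideal.Quotient.mk I) = p := by
    rw [Ideal.comap_map_of_surjective _ Ideal.Quotient.mk_surjective, ← RingHom.ker_eq_comap_bot, Ideal.mk_ker, sup_eq_left]
    exact hIp
  have hmem : ∀ c : S, Ideal.Quotient.mk I c ∈ p.map (Ideal.Quotient.mk I) ↔ c ∈ p := fun c => by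
    rw [← Ideal.mem_comap, hcomap]
  ext b
  constructor
  · rintro ⟨c, hc, rfl⟩
    exact fun h => hc ((hmem c).mp h)
  · intro hb
    obtain ⟨c, rfl⟩ := Ideal.Quotient.mk_surjective b
    exact ⟨c, fun h => hb ((hmem c).mpr h), rfl⟩

/-- [OURS · L1 W5.2 · F7(β) (β-AX) T3 / LC · res-L1-w52-plan-1 RULING G12-1 (3)] **THE EXTRACTION LEMMA (EQ): a hypersurface that is
permissible (CJS Def. 3.1) along a regular centre is EQUIMULTIPLE along it.**  Let `S` be a regular local ring, `p` a prime with `S/p` regular,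
`h ∈ p`, `h ≠ 0`, and suppose `p/(h)` is permissible in `S/(h)`.  Then the `𝔪`-adic order of `h` equals its order in the localisation `S_p`,
i.e. the multiplicity of the hypersurface `h = 0` at the closed point equals its multiplicity at the generic point of the centre.
[cite: CossartJannsenSaito2020, Thm. 3.3] [cite: Hironaka1964, Ch. II §1] -/
theorem mOrder_eq_mOrder_localization_of_isPermissible [IsRegularLocalRing S] (p : Ideal S) [p.IsPrime] [IsRegularLocalRing (S ⧸ p)]
    {h : S} (hh : h ∈ p) (h0 : h ≠ 0) (hperm : (p.map (Ideal.Quotient.mk (Ideal.span {h}))).IsPermissible) :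
    mOrder h = mOrder (algebraMap S (Localization.AtPrime p) h) := by
  classical
  -- the players
  set Sp := Localization.AtPrime p with hSp_def
  set h' : Sp := algebraMap S Sp h with hh'_def
  set I : Ideal S := Ideal.span {h} with hI_def
  set pb : Ideal (S ⧸ I) := p.map (Ideal.Quotient.mk I) with hpb_def
  have hIp : I ≤ p := by rw [hI_def, Ideal.span_le, Set.singleton_subset_iff]; exact hh
  haveI : IsDomain S := Literature.AlgebraicGeometry.Resolution.isDomain_of_isRegularLocalRing S
  haveI : IsRegularRing S := Literature.AlgebraicGeometry.Resolution.isRegularRing_of_isRegularLocalRing S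
  haveI : Nontrivial (S ⧸ I) := Ideal.Quotient.nontrivial_iff.mpr (fun hI => by
    rw [hI_def, Ideal.span_singleton_eq_top] at hI
    exact (IsLocalRing.notMem_maximalIdeal.mpr hI) (IsLocalRing.le_maximalIdeal (Ideal.IsPrime.ne_top inferInstance) hh))
  haveI : IsLocalRing (S ⧸ I) := .of_surjective' _ Ideal.Quotient.mk_surjective
  haveI : IsRegularLocalRing ((S ⧸ I) ⧸ pb) := hperm.1
  haveI hpb : pb.IsPrime :=
    (Ideal.Quotient.isDomain_iff_prime pb).mp (Literature.AlgebraicGeometry.Resolution.isDomain_of_isRegularLocalRing _)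
  -- `Rp := S_p/(h)`, a localisation of `S/(h)` at `p̄`
  set Rp := Sp ⧸ I.map (algebraMap S Sp) with hRp_def
  have hI' : I.map (algebraMap S Sp) = Ideal.span {h'} := by rw [hI_def, Ideal.map_span, Set.image_singleton]
  have hh'm : h' ∈ maximalIdeal Sp := by
    rw [← Localization.AtPrime.map_eq_maximalIdeal]; exact Ideal.mem_map_of_mem _ hh
  have hI'top : I.map (algebraMap S Sp) ≠ ⊤ := fun htop => by
    rw [hI', Ideal.span_singleton_eq_top] at htop
    exact (IsLocalRing.notMem_maximalIdeal.mpr htop) hh'm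
  haveI : Nontrivial Rp := Ideal.Quotient.nontrivial_iff.mpr hI'top
  haveI : IsLocalRing Rp := .of_surjective' _ Ideal.Quotient.mk_surjective
  haveI : IsLocalization.AtPrime Rp pb := by
    have hM : Algebra.algebraMapSubmonoid (S ⧸ I) p.primeCompl = pb.primeCompl := algebraMapSubmonoid_quotient_eq p I hIp
    change IsLocalization pb.primeCompl Rp
    rw [← hM]
    infer_instance
  -- dimensions `d = c + r`
  obtain ⟨d, hd⟩ := Literature.AlgebraicGeometry.Resolution.exists_ringKrullDim_eq_natCast S
  obtain ⟨c, hc⟩ := Literature.AlgebraicGeometry.Resolution.exists_ringKrullDim_eq_natCast Sp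
  obtain ⟨r, hr⟩ := Literature.AlgebraicGeometry.Resolution.exists_ringKrullDim_eq_natCast (S ⧸ p)
  have hdcr : d = r + c := by
    have h1 := Literature.AlgebraicGeometry.Resolution.height_add_ringKrullDim_quotient (S := S) p
    have h2 : ((p.height : ℕ∞) : WithBot ℕ∞) = (c : WithBot ℕ∞) := by
      rw [← IsLocalization.AtPrime.ringKrullDim_eq_height p Sp]; exact hc
    rw [h2, hr, hd] at h1
    have h3 : ((c + r : ℕ) : WithBot ℕ∞) = (d : WithBot ℕ∞) := by rw [← h1]; push_cast; rfl
    have := WithBot.coe_inj.mp h3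
    have := ENat.coe_inj.mp (by exact_mod_cast this)
    omega
  have hrb : ringKrullDim ((S ⧸ I) ⧸ pb) = r := by
    rw [ringKrullDim_eq_of_ringEquiv (DoubleQuot.quotQuotEquivQuotOfLE hIp)]; exact hr
  -- (1) normal flatness: `H_{S/(h)} = H⁽ʳ⁾_{S_p/(h)}`
  have hEq : hilbertFun (S ⧸ I) = hilbertSamuelFun Rp r := hilbertFun_eq_hilbertSamuelFun_of_isNormallyFlat pb Rp hrb hperm.2.1
  -- (2) the regular Hilbert functions
  have hS : hilbertFun S = iterPSum d Phi := hilbertFun_eq_iterPSum_Phi_of_isRegularLocalRing S hd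
  have hSpf : hilbertFun Sp = iterPSum c Phi := hilbertFun_eq_iterPSum_Phi_of_isRegularLocalRing Sp hc
  -- the two orders
  have hνt : mOrder h ≠ ⊤ := by rw [Ne, mOrder_eq_top_iff_eq_zero]; exact h0
  have h0' : h' ≠ 0 := fun e => h0 (IsLocalization.injective Sp p.primeCompl_le_nonZeroDivisors (by rw [map_zero]; exact e))
  have hμt : mOrder h' ≠ ⊤ := by rw [Ne, mOrder_eq_top_iff_eq_zero]; exact h0'
  set ν := (mOrder h).toNat with hν_def
  set μ := (mOrder h').toNat with hμ_def
  have hνm : h ∈ maximalIdeal S ^ ν := mem_pow_toNat_mOrder hνt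
  have hνm' : h ∉ maximalIdeal S ^ (ν + 1) := not_mem_pow_toNat_mOrder_succ hνt
  have hμm : h' ∈ maximalIdeal Sp ^ μ := mem_pow_toNat_mOrder hμt
  have hμm' : h' ∉ maximalIdeal Sp ^ (μ + 1) := not_mem_pow_toNat_mOrder_succ hμt
  -- the surjections and their kernels
  have hfS : Function.Surjective (algebraMap S (S ⧸ I)) := Ideal.Quotient.mk_surjective
  have hfSp : Function.Surjective (algebraMap Sp Rp) := Ideal.Quotient.mk_surjective
  have hkS : RingHom.ker (algebraMap S (S ⧸ I)) = Ideal.span {h} := Ideal.mk_ker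
  have hkSp : RingHom.ker (algebraMap Sp Rp) = Ideal.span {h'} := by rw [← hI']; exact Ideal.mk_ker
  -- §1 read on both sides
  have A1 : ∀ n < ν, hilbertFun (S ⧸ I) n = hilbertFun S n := fun n hn =>
    hilbertFun_eq_of_ker_le_pow hfS (by rw [hkS, Ideal.span_le, Set.singleton_subset_iff]; exact hνm) hn
  have A2 : hilbertFun (S ⧸ I) ν + 1 = hilbertFun S ν := hilbertFun_add_one_eq_of_ker_eq_span hfS hkS hνm hνm'
  have B1 : ∀ n < μ, hilbertFun Rp n = iterPSum c Phi n := fun n hn => by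
    rw [← hSpf]; exact hilbertFun_eq_of_ker_le_pow hfSp (by rw [hkSp, Ideal.span_le, Set.singleton_subset_iff]; exact hμm) hn
  have B2 : hilbertFun Rp μ + 1 = iterPSum c Phi μ := by rw [← hSpf]; exact hilbertFun_add_one_eq_of_ker_eq_span hfSp hkSp hμm hμm'
  -- compare at `min ν μ`
  suffices hνμ : ν = μ by
    rw [← ENat.coe_toNat hνt, ← ENat.coe_toNat hμt, ← hν_def, ← hμ_def, hνμ]
  rcases lt_trichotomy ν μ with hlt | heq | hgt
  · exfalso
    have e1 : hilbertFun (S ⧸ I) ν = iterPSum r (hilbertFun Rp) ν := by rw [hEq]; rfl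
    have e2 : iterPSum r (hilbertFun Rp) ν = iterPSum r (iterPSum c Phi) ν :=
      iterPSum_eq_of_eq_below (n := ν + 1) (fun i hi => B1 i (by omega)) r ν (Nat.lt_succ_self ν)
    rw [e2, ← iterPSum_add, ← hdcr, ← hS] at e1
    omega
  · exact heq
  · exfalso
    have e1 : hilbertFun (S ⧸ I) μ = iterPSum r (hilbertFun Rp) μ := by rw [hEq]; rfl
    have e2 : iterPSum r (hilbertFun Rp) μ + 1 = iterPSum r (iterPSum c Phi) μ := iterPSum_add_one_eq B1 B2 r
    rw [← iterPSum_add, ← hdcr, ← hS, ← e1, A1 μ hgt] at e2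
    omega

/-- [OURS · (EQ), membership form] Under the hypotheses of the extraction lemma, `h ∈ 𝔪ⁿ` iff `h ∈ (pS_p)ⁿ` — the order at the closed point
is the generic order along the centre. [cite: CossartJannsenSaito2020, Thm. 3.3] -/
theorem mem_pow_maximalIdeal_iff_of_isPermissible [IsRegularLocalRing S] (p : Ideal S) [p.IsPrime] [IsRegularLocalRing (S ⧸ p)] {h : S}
    (hh : h ∈ p) (h0 : h ≠ 0) (hperm : (p.map (Ideal.Quotient.mk (Ideal.span {h}))).IsPermissible) (n : ℕ) :
    h ∈ maximalIdeal S ^ n ↔ algebraMap S (Localization.AtPrime p) h ∈ maximalIdeal (Localization.AtPrime p) ^ n := by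
  rw [← le_mOrder_iff, ← le_mOrder_iff, mOrder_eq_mOrder_localization_of_isPermissible p hh h0 hperm]

end Main
/-! ## §3 The factor corollary: every factor of an equimultiple product is equimultiple -/
section Factors

variable {S : Type u} [CommRing S]

/-- The two order functions of the tree agree: `adicOrder = mOrder` (same definition). [folklore] -/
theorem adicOrder_eq_mOrder [IsLocalRing S] (f : S) : Literature.AlgebraicGeometry.Resolution.adicOrder f = mOrder f := rfl

/-- **Orders add on products in a regular local ring** (`mOrder` currency; = `adicOrder_mul`). [folklore] -/
theorem mOrder_mul [IsRegularLocalRing S] (f g : S) : mOrder (f * g) = mOrder f + mOrder g := by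
  rw [← adicOrder_eq_mOrder, ← adicOrder_eq_mOrder, ← adicOrder_eq_mOrder]
  exact Literature.AlgebraicGeometry.Resolution.adicOrder_mul f g

/-- Orders add on finite products in a regular local ring. [folklore] -/
theorem mOrder_prod [IsRegularLocalRing S] {ι : Type*} (s : Finset ι) (g : ι → S) : mOrder (∏ i ∈ s, g i) = ∑ i ∈ s, mOrder (g i) := by
  classical
  induction s using Finset.induction_on with
  | empty => rw [Finset.prod_empty, Finset.sum_empty]; exact mOrder_eq_zero_of_isUnit isUnit_one
  | insert a s ha ih => rw [Finset.prod_insert ha, Finset.sum_insert ha, mOrder_mul, ih]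

/-- **Generisation lowers the order** (`mOrder` currency; = `mem_pow_of_algebraMap_mem_pow`): the order of `g` in the localisation `S_p` of a
regular local ring is at most its `𝔪`-adic order. [cite: CossartPiltant2008, Prop. 4.2 (proof)] -/
theorem mOrder_localization_le [IsRegularLocalRing S] (p : Ideal S) [p.IsPrime] (g : S) :
    mOrder (algebraMap S (Localization.AtPrime p) g) ≤ mOrder g := by
  rcases eq_or_ne (mOrder (algebraMap S (Localization.AtPrime p) g)) ⊤ with htop | hne
  · -- then `g = 0`
    haveI : IsDomain S := Literature.AlgebraicGeometry.Resolution.isDomain_of_isRegularLocalRing S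
    haveI : IsRegularRing S := Literature.AlgebraicGeometry.Resolution.isRegularRing_of_isRegularLocalRing S
    rw [mOrder_eq_top_iff_eq_zero] at htop
    have hg : g = 0 := IsLocalization.injective (Localization.AtPrime p) p.primeCompl_le_nonZeroDivisors (by rw [map_zero]; exact htop)
    rw [hg, mOrder_zero]; exact le_top
  · rw [← ENat.coe_toNat hne, le_mOrder_iff]
    exact Literature.AlgebraicGeometry.Resolution.mem_pow_of_algebraMap_mem_pow p (Localization.AtPrime p) (mem_pow_toNat_mOrder hne)

/-- Finite sums in `ℕ∞` with termwise `≤` and equal finite totals are termwise equal. [folklore] -/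
theorem eq_of_sum_eq_of_le {ι : Type*} (s : Finset ι) {a b : ι → ℕ∞} (hle : ∀ i ∈ s, b i ≤ a i) (hfin : ∀ i ∈ s, a i ≠ ⊤)
    (hsum : ∑ i ∈ s, a i = ∑ i ∈ s, b i) : ∀ i ∈ s, a i = b i := by
  have hfinb : ∀ i ∈ s, b i ≠ ⊤ := fun i hi h => hfin i hi (eq_top_iff.mpr (h ▸ hle i hi))
  have ha : ∑ i ∈ s, a i = ((∑ i ∈ s, (a i).toNat : ℕ) : ℕ∞) := by
    rw [Nat.cast_sum]; exact Finset.sum_congr rfl fun i hi => (ENat.coe_toNat (hfin i hi)).symm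
  have hb : ∑ i ∈ s, b i = ((∑ i ∈ s, (b i).toNat : ℕ) : ℕ∞) := by
    rw [Nat.cast_sum]; exact Finset.sum_congr rfl fun i hi => (ENat.coe_toNat (hfinb i hi)).symm
  rw [ha, hb, ENat.coe_inj] at hsum
  have hle' : ∀ i ∈ s, (b i).toNat ≤ (a i).toNat := fun i hi => ENat.toNat_le_toNat (hle i hi) (hfin i hi)
  have heq := (Finset.sum_eq_sum_iff_of_le hle').mp hsum.symm
  intro i hi
  rw [← ENat.coe_toNat (hfin i hi), ← ENat.coe_toNat (hfinb i hi), heq i hi]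

/-- [OURS · L1 W5.2 · F7(β) (β-AX) T3 / LC · RULING G12-1 (3), FACTOR COROLLARY] **Every factor of a permissible reduced host equation is
equimultiple along the centre.**  If `h = ∏_{i ∈ s} g_i` (all `g_i ≠ 0`) lies in `p`, `S` and `S/p` are regular and `p/(h)` is permissible in
`S/(h)`, then for every `i ∈ s` the `𝔪`-adic order of `g_i` equals its order in `S_p` («every host trace through a point of the centre contains it
with its generic order»).  Orders add on products in `S` and in `S_p` (`mOrder_prod`), the generic order never exceeds the special one termwise
(`mOrder_localization_le`), and the totals agree by the extraction lemma. [cite: CossartJannsenSaito2020, Thm. 3.3] -/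
theorem mOrder_eq_mOrder_localization_of_prod [IsRegularLocalRing S] (p : Ideal S) [p.IsPrime] [IsRegularLocalRing (S ⧸ p)] {ι : Type*}
    (s : Finset ι) (g : ι → S) (hg0 : ∀ i ∈ s, g i ≠ 0) (hh : ∏ i ∈ s, g i ∈ p)
    (hperm : (p.map (Ideal.Quotient.mk (Ideal.span {∏ i ∈ s, g i}))).IsPermissible) :
    ∀ i ∈ s, mOrder (g i) = mOrder (algebraMap S (Localization.AtPrime p) (g i)) := by
  haveI : IsDomain S := Literature.AlgebraicGeometry.Resolution.isDomain_of_isRegularLocalRing S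
  haveI : IsRegularRing S := Literature.AlgebraicGeometry.Resolution.isRegularRing_of_isRegularLocalRing S
  have h0 : ∏ i ∈ s, g i ≠ 0 := Finset.prod_ne_zero_iff.mpr hg0
  have hEQ := mOrder_eq_mOrder_localization_of_isPermissible p hh h0 hperm
  rw [map_prod, mOrder_prod, mOrder_prod] at hEQ
  exact eq_of_sum_eq_of_le s (fun i _ => mOrder_localization_le p (g i)) (fun i hi => by rw [Ne, mOrder_eq_top_iff_eq_zero]; exact hg0 i hi) hEQ

/-- Orders of powers in a regular local ring. [folklore] -/
theorem mOrder_pow [IsRegularLocalRing S] (f : S) (N : ℕ) : mOrder (f ^ N) = N * mOrder f := by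
  induction N with
  | zero => rw [pow_zero, Nat.cast_zero, zero_mul]; exact mOrder_eq_zero_of_isUnit isUnit_one
  | succ N ih => rw [pow_succ, mOrder_mul, ih, Nat.cast_succ, add_mul, one_mul]

/-- [OURS · L1 W5.2 · F7(β) (β-AX) T3 · G12-8, NON-REDUCED HOST TRACES] **Every divisor of a power of a permissible reduced host equation is
equimultiple along the centre**: under the hypotheses of the extraction lemma on `h`, if `f ∣ h ^ N` (e.g. a host trace `f = ∏ g_j^{e_j}` whose
prime factors divide the reduced equation `h`, like `H²` or `H₁H₂` in idea-1's K12) then `ord_𝔪 f = ord_{S_p} f`; in particular `f ∉ p` forces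
`f` to be a unit («a host trace that does not contain the centre misses the point»). [cite: CossartJannsenSaito2020, Thm. 3.3] -/
theorem mOrder_eq_mOrder_localization_of_dvd_pow [IsRegularLocalRing S] (p : Ideal S) [p.IsPrime] [IsRegularLocalRing (S ⧸ p)] {h : S}
    (hh : h ∈ p) (h0 : h ≠ 0) (hperm : (p.map (Ideal.Quotient.mk (Ideal.span {h}))).IsPermissible) {f : S} {N : ℕ} (hf : f ∣ h ^ N) :
    mOrder f = mOrder (algebraMap S (Localization.AtPrime p) f) := by
  classical
  haveI : IsDomain S := Literature.AlgebraicGeometry.Resolution.isDomain_of_isRegularLocalRing S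
  haveI : IsRegularRing S := Literature.AlgebraicGeometry.Resolution.isRegularRing_of_isRegularLocalRing S
  obtain ⟨q, hq⟩ := hf
  have hN0 : h ^ N ≠ 0 := pow_ne_zero N h0
  have hf0 : f ≠ 0 := fun e => hN0 (by rw [hq, e, zero_mul])
  have hq0 : q ≠ 0 := fun e => hN0 (by rw [hq, e, mul_zero])
  -- `ord (h^N)` agrees on both sides, and splits as `ord f + ord q` on both sides
  have hEQ := mOrder_eq_mOrder_localization_of_isPermissible p hh h0 hperm
  have hsum : mOrder f + mOrder q = mOrder (algebraMap S (Localization.AtPrime p) f) + mOrder (algebraMap S (Localization.AtPrime p) q) := by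
    rw [← mOrder_mul, ← mOrder_mul, ← map_mul, ← hq, map_pow, mOrder_pow, mOrder_pow, hEQ]
  -- two-term version of `eq_of_sum_eq_of_le`, on the pair `(f, q)`
  have key := eq_of_sum_eq_of_le (Finset.univ : Finset Bool) (a := fun b => if b then mOrder f else mOrder q)
    (b := fun b => if b then mOrder (algebraMap S (Localization.AtPrime p) f) else mOrder (algebraMap S (Localization.AtPrime p) q))
    (fun b _ => by cases b <;> exact mOrder_localization_le p _)
    (fun b _ => by cases b <;> simp only [Bool.false_eq_true, if_false, if_true, Ne, mOrder_eq_top_iff_eq_zero] <;> assumption)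
    (by simpa only [Fintype.sum_bool, if_true, if_false, Bool.false_eq_true] using hsum)
  simpa only [if_true] using key true (Finset.mem_univ true)

/-- Hence a divisor of a power of `h` that does not lie in `p` is a unit. [folklore] -/
theorem isUnit_of_dvd_pow_of_not_mem [IsRegularLocalRing S] (p : Ideal S) [p.IsPrime] [IsRegularLocalRing (S ⧸ p)] {h : S} (hh : h ∈ p)
    (h0 : h ≠ 0) (hperm : (p.map (Ideal.Quotient.mk (Ideal.span {h}))).IsPermissible) {f : S} {N : ℕ} (hf : f ∣ h ^ N) (hfp : f ∉ p) :
    IsUnit f := by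
  have h1 : mOrder (algebraMap S (Localization.AtPrime p) f) = 0 :=
    mOrder_eq_zero_of_isUnit ((IsLocalization.AtPrime.isUnit_to_map_iff (Localization.AtPrime p) p f).mpr hfp)
  have h2 : mOrder f = 0 := by rw [mOrder_eq_mOrder_localization_of_dvd_pow p hh h0 hperm hf, h1]
  by_contra hu
  have hm : f ∈ maximalIdeal S ^ 1 := by rw [pow_one]; exact (IsLocalRing.mem_maximalIdeal f).mpr hu
  have := (le_mOrder_iff f 1).mpr hm
  rw [h2] at this
  exact absurd this (by decide)

end Factors
end Summit.ResolutionOfSingularities.ResolutionOfSingularities.Theorems.DepthEquimultiple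

end
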